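import Summits.CriticalPhenomena.Ising3DConformalLimit.Theorems.GaussianLimitNotScreened.Negative.ModelBlind

/-!
# `GaussianLimitNotScreened` (stmt-CriticalPhenomena-13886) is model-blind-false AT ALL ORDERS

Negative knowledge about the crux `…Theses.PerfectScreening.GaussianLimitNotScreened` (r4 of route
PerfectScreening), standing crux disprover (D-0016); supports the item, closes nothing. Continues
`Negative/ModelBlind.lean`, whose witness populated only the arities `2` and `4`. Here the hafnian
(all-orders Wick, free-field moment) family `haf K` of a pair kernel is developed — recursion along
the first point, invariance (`haf_map`), homogeneity (`pow_mul_haf`), scale and inversion covariance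
(`haf_smul`, `haf_inversion`), `U₄ ≡ 0` (`limitConnectedFour_haf`), locally uniform convergence at
every order (`tendsto_haf`) — and the model-blind crux is refuted again, in the stronger pinned-limit form `screened_family_with_freeField_limit`,
with `screenedLatticeAll := haf gL`, an honest Gaussian lattice moment family at EVERY order, whose
pointwise scaling limit is the massless free field with ALL its correlators
(`freeField := haf ‖·-·‖⁻¹`, `freeField_isMoebiusCovariant`, `screenedLatticeAll_hasLimit`).
So the repair "require the limit `S` to be the full free field" does not rescue a limit-side proof.
(No hafnian / free-field family existed in Mathlib or `Literature` before; cf. the module docstring of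
`Literature/MathematicalPhysics/QuantumFieldTheory/BootstrapIslandMeanField.lean`.)
-/

noncomputable section

namespace Summit.CriticalPhenomena.Ising3DConformalLimit.GaussianLimitNotScreenedNegative

open Literature.Probability.LatticeModels Filter Topology Metric
open Literature.Barriers.CriticalPhenomena.ScaleNotMoebius (tendstoLocallyUniformlyOn_congr_eventually)

/-! ## (a3) All-orders version: the witness as an honest Gaussian moment family (hafnians)

To pre-empt the repair "require `S` (and the lattice family) to be the FULL free field at every
order": the hafnian (all-orders Wick) family `haf K` of a pair kernel `K` — `haf K 0 = 1`,
`haf K 1 = 0`, `haf K (n+2) x = Σⱼ K(x₀, x_{j+1}) · haf K n (x minus {0, j+1})` — is Möbius covariant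
with dimension `Δ` whenever `K` is a covariant two-point kernel, has `U₄ ≡ 0`, and the hafnian
family of the screened kernel `gL` converges AT EVERY ORDER to the hafnian family of `‖a-b‖⁻¹`, i.e.
to the massless free field with all its correlators. -/

section Hafnian

variable {α : Type*}

/-- Removal of the indices `0` and `j.succ` from `Fin (n+2)`, as an order-preserving map
`Fin n → Fin (n+2)`. [folklore] -/
def rem {n : ℕ} (j : Fin (n + 1)) (i : Fin n) : Fin (n + 2) := (j.succAbove i).succ

/-- `rem j` is injective. [folklore] -/
theorem rem_injective {n : ℕ} (j : Fin (n + 1)) : Function.Injective (rem j) :=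
  fun _ _ h => Fin.succAbove_right_injective (Fin.succ_injective _ h)

/-- `rem j` avoids `0`. [folklore] -/
theorem rem_ne_zero {n : ℕ} (j : Fin (n + 1)) (i : Fin n) : rem j i ≠ 0 := Fin.succ_ne_zero _

/-- `rem j` avoids `j.succ`. [folklore] -/
theorem rem_ne_succ {n : ℕ} (j : Fin (n + 1)) (i : Fin n) : rem j i ≠ j.succ := by
  intro h
  exact Fin.succAbove_ne j i (Fin.succ_injective _ h)

/-- The hafnian (all-orders Wick / free-field moment) family of a pair kernel. [folklore] -/
def haf (K : α → α → ℝ) : (n : ℕ) → (Fin n → α) → ℝ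
  | 0, _ => 1
  | 1, _ => 0
  | n + 2, x => ∑ j : Fin (n + 1), K (x 0) (x j.succ) * haf K n (fun i => x (rem j i))

/-- `haf K 0 = 1`. [folklore] -/
@[simp] theorem haf_zero (K : α → α → ℝ) (x : Fin 0 → α) : haf K 0 x = 1 := rfl
/-- `haf K 1 = 0`. [folklore] -/
@[simp] theorem haf_one (K : α → α → ℝ) (x : Fin 1 → α) : haf K 1 x = 0 := rfl
/-- The recursion (expansion along the first point). [folklore] -/
theorem haf_succ_succ (K : α → α → ℝ) (n : ℕ) (x : Fin (n + 2) → α) :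
    haf K (n + 2) x = ∑ j : Fin (n + 1), K (x 0) (x j.succ) * haf K n (fun i => x (rem j i)) := rfl

/-- `haf K 2 (a, b) = K a b`. [folklore] -/
theorem haf_two (K : α → α → ℝ) (x : Fin 2 → α) : haf K 2 x = K (x 0) (x 1) := by
  simp [haf_succ_succ]

/-- The hafnian is invariant under maps preserving the kernel. [folklore] -/
theorem haf_map {β : Type*} (K : α → α → ℝ) (K' : β → β → ℝ) (φ : α → β)
    (hK : ∀ a b, K' (φ a) (φ b) = K a b) : ∀ (n : ℕ) (x : Fin n → α), haf K' n (φ ∘ x) = haf K n x := by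
  intro n
  induction n using Nat.twoStepInduction with
  | zero => intro x; rfl
  | one => intro x; rfl
  | more n ih _ =>
    intro x
    rw [haf_succ_succ, haf_succ_succ]
    refine Finset.sum_congr rfl fun j _ => ?_
    rw [Function.comp_apply, Function.comp_apply, hK]
    congr 1
    exact ih (fun i => x (rem j i))

/-- Homogeneity: scaling the kernel by `c` scales `haf K n` like `ρⁿ` with `ρ² = c`; precisely
`ρ ^ n * haf K n x = haf (ρ² K) n x`. [folklore] -/
theorem pow_mul_haf (K : α → α → ℝ) (ρ : ℝ) :
    ∀ (n : ℕ) (x : Fin n → α), ρ ^ n * haf K n x = haf (fun a b => ρ ^ 2 * K a b) n x := by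
  intro n
  induction n using Nat.twoStepInduction with
  | zero => intro x; simp
  | one => intro x; simp
  | more n ih _ =>
    intro x
    rw [haf_succ_succ, haf_succ_succ, Finset.mul_sum]
    refine Finset.sum_congr rfl fun j _ => ?_
    rw [← ih]
    ring

/-- Scale covariance of the hafnian family of a kernel of dimension `Δ` on `ℝ³`. [folklore] -/
theorem haf_smul (K : EuclideanSpace ℝ (Fin 3) → EuclideanSpace ℝ (Fin 3) → ℝ) (Δ : ℝ) {c : ℝ} (hc : 0 < c)
    (hK : ∀ a b, K (c • a) (c • b) = c ^ (-(2 * Δ)) * K a b) :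
    ∀ (n : ℕ) (x : Fin n → EuclideanSpace ℝ (Fin 3)),
      haf K n (fun i => c • x i) = c ^ (-(n : ℝ) * Δ) * haf K n x := by
  intro n
  induction n using Nat.twoStepInduction with
  | zero => intro x; simp
  | one => intro x; simp
  | more n ih _ =>
    intro x
    rw [haf_succ_succ, haf_succ_succ, Finset.mul_sum]
    refine Finset.sum_congr rfl fun j _ => ?_
    have h2 := ih (fun i => x (rem j i))
    rw [hK, h2]
    have hexp : c ^ (-((n + 2 : ℕ) : ℝ) * Δ) = c ^ (-(2 * Δ)) * c ^ (-(n : ℝ) * Δ) := by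
      rw [← Real.rpow_add hc]; congr 1; push_cast; ring
    rw [hexp]; ring

/-- Inversion covariance of the hafnian family of an inversion-covariant kernel. [folklore] -/
theorem haf_inversion (K : EuclideanSpace ℝ (Fin 3) → EuclideanSpace ℝ (Fin 3) → ℝ) (Δ : ℝ)
    (hK : ∀ a b, a ≠ 0 → b ≠ 0 →
      K (EuclideanGeometry.inversion 0 1 a) (EuclideanGeometry.inversion 0 1 b) =
        ‖a‖ ^ (2 * Δ) * ‖b‖ ^ (2 * Δ) * K a b) :
    ∀ (n : ℕ) (x : Fin n → EuclideanSpace ℝ (Fin 3)), (∀ i, x i ≠ 0) →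
      haf K n (fun i => EuclideanGeometry.inversion 0 1 (x i)) = (∏ i, ‖x i‖ ^ (2 * Δ)) * haf K n x := by
  intro n
  induction n using Nat.twoStepInduction with
  | zero => intro x _; simp
  | one => intro x _; simp
  | more n ih _ =>
    intro x hx
    rw [haf_succ_succ, haf_succ_succ, Finset.mul_sum]
    refine Finset.sum_congr rfl fun j _ => ?_
    have h2 := ih (fun i => x (rem j i)) (fun i => hx _)
    rw [hK _ _ (hx _) (hx _), h2, Fin.prod_univ_succ, Fin.prod_univ_succAbove _ j]
    simp only [rem]
    ring

/-- The connected four-point function of a hafnian family vanishes identically (the order-4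
recursion IS the Wick sum, in the order used by `limitConnectedFour`). [folklore] -/
theorem limitConnectedFour_haf (K : EuclideanSpace ℝ (Fin 3) → EuclideanSpace ℝ (Fin 3) → ℝ)
    (x : Fin 4 → EuclideanSpace ℝ (Fin 3)) :
    limitConnectedFour (haf K) x = 0 := by
  simp [limitConnectedFour, haf_succ_succ, Fin.sum_univ_succ, rem, Fin.succAbove]
  ring

/-- Finite sums of locally uniformly convergent real functions converge locally uniformly. [folklore] -/
theorem tendstoLocallyUniformlyOn_finset_sum {ι X κ : Type*} [TopologicalSpace X]
    {p : Filter ι} {s : Set X} (t : Finset κ) (F : κ → ι → X → ℝ) (f : κ → X → ℝ)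
    (h : ∀ k ∈ t, TendstoLocallyUniformlyOn (F k) (f k) p s) :
    TendstoLocallyUniformlyOn (fun i x => ∑ k ∈ t, F k i x) (fun x => ∑ k ∈ t, f k x) p s := by
  classical
  induction t using Finset.induction_on with
  | empty =>
    simp only [Finset.sum_empty]
    exact ((tendsto_const_nhds (x := (0:ℝ))).tendstoUniformlyOn_const s).tendstoLocallyUniformlyOn
  | insert a t ha ih =>
    simp only [Finset.sum_insert ha]
    exact (h a (Finset.mem_insert_self a t)).add (ih fun k hk => h k (Finset.mem_insert_of_mem hk))

/-- Removing two points maps non-coincident configurations to non-coincident ones. [folklore] -/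
theorem mapsTo_rem {n : ℕ} (j : Fin (n + 1)) :
    Set.MapsTo (fun x : Fin (n + 2) → EuclideanSpace ℝ (Fin 3) => fun i => x (rem j i))
      (NonCoincident 3 (n + 2)) (NonCoincident 3 n) :=
  fun x hx => (mem_nonCoincident _).2 (((mem_nonCoincident x).1 hx).comp (rem_injective j))

/-- The free-field hafnian family `haf (‖·-·‖⁻¹) n` is continuous on non-coincident configurations. [folklore] -/
theorem continuousOn_haf_inv : ∀ n : ℕ, ContinuousOn
    (haf (fun a b : EuclideanSpace ℝ (Fin 3) => ‖a - b‖⁻¹) n) (NonCoincident 3 n) := by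
  intro n
  induction n using Nat.twoStepInduction with
  | zero => exact continuousOn_const
  | one => exact continuousOn_const
  | more n ih _ =>
    simp only [funext (haf_succ_succ _ n)]
    refine continuousOn_finsetSum _ fun j _ => ?_
    refine (continuousOn_inv_dist (0 : Fin (n+2)) j.succ (Fin.succ_ne_zero j).symm).mul ?_
    exact ih.comp (by fun_prop) (mapsTo_rem j)

/-- **All orders**: the rescaled hafnian family of the level-`(1 - log δ)` comparison kernel at the
rounded configuration converges to the free-field hafnian family, locally uniformly on non-coincident
configurations, for EVERY `n`. [folklore] -/
theorem tendsto_haf : ∀ n : ℕ, TendstoLocallyUniformlyOn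
    (fun δ x => haf (fun a b : EuclideanSpace ℝ (Fin 3) => psi (1 - Real.log δ) ‖a - b‖) n (roundCfg δ x))
    (haf (fun a b : EuclideanSpace ℝ (Fin 3) => ‖a - b‖⁻¹) n) (𝓝[>] 0) (NonCoincident 3 n) := by
  intro n
  induction n using Nat.twoStepInduction with
  | zero =>
    exact (((tendsto_const_nhds (x := (1:ℝ))).tendstoUniformlyOn_const _).tendstoLocallyUniformlyOn).congr
      (fun δ x _ => by simp) |>.congr_right fun x _ => by simp
  | one =>
    exact (((tendsto_const_nhds (x := (0:ℝ))).tendstoUniformlyOn_const _).tendstoLocallyUniformlyOn).congr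
      (fun δ x _ => by simp) |>.congr_right fun x _ => by simp
  | more n ih _ =>
    have hsum := tendstoLocallyUniformlyOn_finset_sum (Finset.univ : Finset (Fin (n + 1)))
      (fun j δ x => psi (1 - Real.log δ) ‖roundCfg δ x 0 - roundCfg δ x j.succ‖ *
        haf (fun a b : EuclideanSpace ℝ (Fin 3) => psi (1 - Real.log δ) ‖a - b‖) n
          (roundCfg δ (fun i => x (rem j i))))
      (fun j x => ‖x 0 - x j.succ‖⁻¹ *
        haf (fun a b : EuclideanSpace ℝ (Fin 3) => ‖a - b‖⁻¹) n (fun i => x (rem j i)))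
      (fun j _ => (tendsto_pair (0 : Fin (n+2)) j.succ (Fin.succ_ne_zero j).symm).mul₀
        (ih.comp _ (mapsTo_rem j) (by fun_prop))
        (continuousOn_inv_dist (0 : Fin (n+2)) j.succ (Fin.succ_ne_zero j).symm)
        ((continuousOn_haf_inv n).comp (by fun_prop) (mapsTo_rem j)))
    refine (hsum.congr fun δ x _ => ?_).congr_right fun x _ => ?_
    · simp only [haf_succ_succ]; rfl
    · simp only [haf_succ_succ]

/-- THE ALL-ORDERS LATTICE WITNESS: the free (hafnian) moment family of the screened kernel `gL`. [folklore] -/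
def screenedLatticeAll : LatticeCorrFamily 3 := haf gL

/-- THE ALL-ORDERS LIMIT: the massless free field on `ℝ³` with all its correlators. [folklore] -/
def freeField : CorrFamily 3 := haf fun a b : EuclideanSpace ℝ (Fin 3) => ‖a - b‖⁻¹

/-- The free field is non-degenerate. [folklore] -/
theorem freeField_isNondegenerateTwoPoint : IsNondegenerateTwoPoint freeField := by
  intro x hx
  rw [freeField, haf_two]
  exact inv_pos.2 (norm_pos_iff.2 (sub_ne_zero.2 (((mem_nonCoincident x).1 hx).ne (by decide))))

/-- The free field has `U₄ ≡ 0`. [folklore] -/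
theorem freeField_not_hasNontrivialU4 : ¬ HasNontrivialU4 freeField := by
  rintro ⟨x, -, hne⟩
  exact hne (limitConnectedFour_haf _ x)

/-- The free field is Möbius covariant with `Δ = 1/2` at every order. [folklore] -/
theorem freeField_isMoebiusCovariant : IsMoebiusCovariant (1/2) freeField := by
  refine ⟨⟨fun n v x => ?_, fun n R x => ?_⟩, fun n c hc x => ?_, fun n x hx => ?_⟩
  · exact haf_map (fun a b : EuclideanSpace ℝ (Fin 3) => ‖a - b‖⁻¹) _ (fun a => a + v)
      (fun a b => by simp) n x
  · exact haf_map (fun a b : EuclideanSpace ℝ (Fin 3) => ‖a - b‖⁻¹) _ R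
      (fun a b => by simp only [← map_sub, LinearIsometryEquiv.norm_map]) n x
  · refine haf_smul _ (1/2) hc (fun a b => ?_) n x
    rw [← smul_sub, norm_smul, Real.norm_eq_abs, abs_of_pos hc, mul_inv,
      show (-(2 * (1/2:ℝ))) = -1 by norm_num, Real.rpow_neg_one]
  · refine haf_inversion _ (1/2) (fun a b ha hb => ?_) n x hx
    have h := gffTwo_inversion (1/2) ha hb
    simpa only [gffTwo_half] using h

/-- The rescaled all-orders witness at mesh `δ ∈ (0,1]` is the comparison hafnian family at the
rounded configuration. [folklore] -/
theorem rescaledCorrelator_screenedLatticeAll {δ : ℝ} (hδ : 0 < δ) (hδ1 : δ ≤ 1) (n : ℕ)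
    (x : Fin n → EuclideanSpace ℝ (Fin 3)) :
    rescaledCorrelator screenedLatticeAll renorm n δ x =
      haf (fun a b : EuclideanSpace ℝ (Fin 3) => psi (1 - Real.log δ) ‖a - b‖) n (roundCfg δ x) := by
  rw [rescaledCorrelator_apply, screenedLatticeAll, pow_mul_haf]
  have hpair : ∀ a b : Site 3, renorm δ ^ 2 * gL a b = psi (1 - Real.log δ) ‖δ • ι a - δ • ι b‖ := by
    intro a b
    rw [gL, renorm_sq_mul_phi hδ hδ1, ← smul_sub, norm_smul, Real.norm_eq_abs, abs_of_pos hδ]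
  exact (haf_map (fun a b : Site 3 => renorm δ ^ 2 * gL a b) _ (fun k => δ • ι k)
    (fun a b => (hpair a b).symm) n _).symm

/-- **All orders: the screened free lattice family has the massless free field as pointwise scaling
limit at every order.** [folklore] -/
theorem screenedLatticeAll_hasLimit : HasPointwiseScalingLimit screenedLatticeAll renorm freeField := by
  intro n
  refine tendstoLocallyUniformlyOn_congr_eventually (tendsto_haf n) ?_
  filter_upwards [Ioc_mem_nhdsGT (zero_lt_one' ℝ)] with δ hδ x _
  exact (rescaledCorrelator_screenedLatticeAll hδ.1 hδ.2 n x).symm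

/-- The all-orders witness has the same two-point function. [folklore] -/
theorem screenedLatticeAll_two (x : Site 3) : screenedLatticeAll 2 ![0, x] = screenedLattice 2 ![0, x] := by
  rw [screenedLatticeAll, haf_two, screenedLattice_two]
  simp [gL, norm_neg]

/-- **Even a lattice family whose pointwise scaling limit IS the full massless free field (every order,
Möbius covariant with `Δ = 1/2`, non-degenerate, `U₄ ≡ 0`) can be perfectly screened** — the all-orders
form of `cruxWithoutIsing_false`, with the limit pinned to `freeField`: witness `screenedLatticeAll`. [folklore] -/
theorem screened_family_with_freeField_limit :
    ¬ ∀ (G : LatticeCorrFamily 3) (ρ : ℝ → ℝ), (∀ δ ∈ Set.Ioc (0:ℝ) 1, 0 < ρ δ) →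
      HasPointwiseScalingLimit G ρ freeField →
      ¬ Tendsto (fun x : Site 3 => ‖x‖ * G 2 ![0, x]) cofinite (𝓝 0) := by
  intro h
  refine h screenedLatticeAll renorm (fun δ hδ => renorm_pos hδ.1 hδ.2) screenedLatticeAll_hasLimit ?_
  simpa only [screenedLatticeAll_two] using screenedLattice_screened

end Hafnian

end Summit.CriticalPhenomena.Ising3DConformalLimit.GaussianLimitNotScreenedNegative

end
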